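import Literature.NumberTheory.Sieve.BetaSieveLargeDimension
import Literature.NumberTheory.Sieve.JurkatRichertRefutation
import HarnessLib

/-!
# Iwaniec's `β`-sieve in dimension `2`: the numerical data

Topic `Literature/NumberTheory/Sieve`. Iwaniec's Rosser-sieve functions of dimension `κ = 2`
(`iwaniecUpperSieveFun 2 = F`, `iwaniecLowerSieveFun 2 = f`, `iwaniecSiftingLimit 2 = β`,
`iwaniecSieveConst 2 = A`; `SieveFunctions.lean`, all PROVED to exist and to satisfy Iwaniec's
Theorem 1 in the tree) are pinned down numerically, as input for the weighted sieve of
Diamond–Halberstam 1997 (`DiamondHalberstamLinearAlmostPrimes.lean`, Table 1, `g = 2`):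

* `iwaniecSiftingLimit_two_gt`, `iwaniecSiftingLimit_two_le`: `4.8339 < β ≤ 4.8341`
  (`β − 1` is the greatest zero of `q_2(u) = u³ − 6u² + 9u − 8/3`,
  `isGreatest_iwaniecSiftingLimit_sub_one` and `SieveAdjoint.qFun_two`; Diamond–Halberstam–Galway,
  *A Higher-Dimensional Sieve Method*, Table 17.1 lists Rosser's `β = 4.8339…` for `κ = 2`).
* `iwaniecUpperSieveFun_two_eq`: `F(s) = A / s²` for `0 < s ≤ β + 1`.
* `sq_mul_iwaniecLowerSieveFun_two_eq`: for `β ≤ s ≤ β + 2`,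
  `s² f(s) = 2A (log(s − 1) − (s − 1)⁻¹ − log(β − 1) + (β − 1)⁻¹)`
  (integrate `(s² f)' = 2 s F(s − 1) = 2As/(s − 1)²` from `β`, where `f(β) = 0`).
* `iwaniecLowerSieveFun_two_ge`: `f(498/73) ≥ 0.02177 · A` (the value used with `z = N^{73/500}`,
  `D = N^{498/500}`; true value `0.021777… · A`).

Everything is proved; no definitions.

## References

* H. Iwaniec, *Rosser's sieve*, Acta Arith. 36 (1980), 171–202, (1.8)–(1.10). [IwaniecActaArith1980]
* G. Greaves, *Sieves in Number Theory* (2001), §4.2.3 (4.2.3.3) (`q_2`), (4.2.4.10). [Greaves2001]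
-/

open Real Set MeasureTheory intervalIntegral

noncomputable section

namespace Literature.NumberTheory.Sieve

namespace BetaSieveTwo

open SieveAdjoint

/-- The dimension-`2` data solve the normalised `β`-sieve system (the tree's existence theorem
`exists_isGreatestBetaSieveData_holds` at `κ = 2`). [cite: IwaniecActaArith1980, (1.8)–(1.10)] -/
theorem isBetaSieveSolution :
    IsBetaSieveSolution 2 (iwaniecUpperSieveFun 2) (iwaniecLowerSieveFun 2) (iwaniecSiftingLimit 2)
      (iwaniecSieveConst 2) :=
  isBetaSieveSolution_iwaniecUpperSieveFun_iwaniecLowerSieveFun exists_isGreatestBetaSieveData_holds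
    (by norm_num)

/-- `A_2 > 0`. [folklore] -/
theorem iwaniecSieveConst_two_pos : 0 < iwaniecSieveConst 2 := isBetaSieveSolution.pos

/-! ### `β_2 ∈ (4.8339, 4.8341]` -/

/-- `q_2(u) = u(u − 3)² − 8/3` is positive for `u > 3.8341` (there `u(u−3)² > 3.8341 · 0.8341² > 8/3`).
[folklore] -/
theorem qFun_two_pos {u : ℝ} (hu : 38341 / 10000 < u) : 0 < qFun 2 u := by
  rw [qFun_two]
  have h1 : (8341 / 10000 : ℝ) ^ 2 < (u - 3) ^ 2 := by nlinarith
  nlinarith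

/-- `q_2(3.8339) < 0`. [folklore] -/
theorem qFun_two_neg : qFun 2 (38339 / 10000) < 0 := by
  rw [qFun_two]; norm_num

/-- `q_2(3.8341) > 0`. [folklore] -/
theorem qFun_two_pos' : 0 < qFun 2 (38341 / 10000) := by
  rw [qFun_two]; norm_num

/-- **`β_2 ≤ 4.8341`**: `β_2 − 1` is a zero of `q_2`, and `q_2 > 0` beyond `3.8341`.
[cite: Greaves2001, (4.2.4.10)] -/
theorem iwaniecSiftingLimit_two_le : iwaniecSiftingLimit 2 ≤ 48341 / 10000 := by
  have h := (isGreatest_iwaniecSiftingLimit_sub_one (κ := 2) (by norm_num)).1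
  obtain ⟨-, h0⟩ := h
  by_contra hlt
  push Not at hlt
  have : 0 < qFun 2 (iwaniecSiftingLimit 2 - 1) := qFun_two_pos (by linarith)
  linarith

/-- **`β_2 > 4.8339`**: `q_2` changes sign on `(3.8339, 3.8341)`, so it has a zero there, which is
at most the greatest zero `β_2 − 1`. [cite: Greaves2001, (4.2.4.10)] -/
theorem iwaniecSiftingLimit_two_gt : 48339 / 10000 < iwaniecSiftingLimit 2 := by
  have hcont : ContinuousOn (fun u : ℝ => qFun 2 u) (Icc (38339 / 10000) (38341 / 10000)) := by
    have : (fun u : ℝ => qFun 2 u) = fun u : ℝ => u ^ 3 - 6 * u ^ 2 + 9 * u - 8 / 3 := by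
      funext u; exact qFun_two u
    rw [this]; fun_prop
  have h0 : (0 : ℝ) ∈ Ioo (qFun 2 (38339 / 10000)) (qFun 2 (38341 / 10000)) :=
    ⟨qFun_two_neg, qFun_two_pos'⟩
  obtain ⟨ρ, hρ, hρ0⟩ := intermediate_value_Ioo (by norm_num) hcont h0
  have hle := (isGreatest_iwaniecSiftingLimit_sub_one (κ := 2) (by norm_num)).2
    ⟨by linarith [hρ.1], hρ0⟩
  linarith [hρ.1]

/-- `β_2 > 1` (indeed `> 4.8`). [folklore] -/
theorem one_lt_iwaniecSiftingLimit_two : 1 < iwaniecSiftingLimit 2 := by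
  linarith [iwaniecSiftingLimit_two_gt]

/-! ### `F_2 = A/s²` on `(0, β + 1]` -/

/-- **`F_2(s) = A_2 / s²` for `0 < s ≤ β_2 + 1`** (the initial condition of the `β`-sieve).
[cite: IwaniecActaArith1980, (1.8)] -/
theorem iwaniecUpperSieveFun_two_eq {s : ℝ} (hs : 0 < s) (hs' : s ≤ iwaniecSiftingLimit 2 + 1) :
    iwaniecUpperSieveFun 2 s = iwaniecSieveConst 2 / s ^ 2 := by
  rw [isBetaSieveSolution.upper_eq s ⟨hs, hs'⟩, Real.rpow_neg hs.le, Real.rpow_two, div_eq_mul_inv]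

/-- `F_2` is antitone on `(0, β_2 + 1]`: `F_2(s') ≤ F_2(s)` for `0 < s ≤ s' ≤ β_2 + 1`. [folklore] -/
theorem iwaniecUpperSieveFun_two_le_of_le {s s' : ℝ} (hs : 0 < s) (hss' : s ≤ s')
    (hs' : s' ≤ iwaniecSiftingLimit 2 + 1) :
    iwaniecUpperSieveFun 2 s' ≤ iwaniecSieveConst 2 / s ^ 2 := by
  rw [iwaniecUpperSieveFun_two_eq (by linarith) hs']
  have hA := iwaniecSieveConst_two_pos
  gcongr

/-! ### `s² f_2(s)` on `[β, β + 2]` -/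

/-- **The lower function on `[β_2, β_2 + 2]`**: for `β_2 ≤ s ≤ β_2 + 2`,
`s² f_2(s) = 2A_2 (log(s − 1) − (s − 1)⁻¹ − log(β_2 − 1) + (β_2 − 1)⁻¹)`, by integrating
`(s² f)' = 2 s F(s − 1) = 2A s/(s − 1)²` from `β_2` (where `f = 0`).
[cite: IwaniecActaArith1980, (1.9)] -/
theorem sq_mul_iwaniecLowerSieveFun_two_eq {s : ℝ} (hs : iwaniecSiftingLimit 2 ≤ s)
    (hs2 : s ≤ iwaniecSiftingLimit 2 + 2) :
    s ^ 2 * iwaniecLowerSieveFun 2 s =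
      2 * iwaniecSieveConst 2 * (Real.log (s - 1) - (s - 1)⁻¹ -
        Real.log (iwaniecSiftingLimit 2 - 1) + (iwaniecSiftingLimit 2 - 1)⁻¹) := by
  have h := isBetaSieveSolution
  set F := iwaniecUpperSieveFun 2
  set f := iwaniecLowerSieveFun 2
  set β := iwaniecSiftingLimit 2 with hβdef
  set A := iwaniecSieveConst 2 with hAdef
  have hβ1 : 1 < β := one_lt_iwaniecSiftingLimit_two
  rcases hs.eq_or_lt with heq | hlt
  · -- `s = β`: both sides vanish
    rw [← heq, h.lower_eq β ⟨by linarith, le_rfl⟩]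
    ring
  -- the derivative of `s² f` on `(β, s]`
  set φ : ℝ → ℝ := fun t => 2 * A * t / (t - 1) ^ 2 with hφ
  have hderiv : ∀ t ∈ Ioo β s, HasDerivWithinAt (fun t : ℝ => t ^ (2 : ℝ) * f t) (φ t) (Ioi t) t := by
    intro t ht
    have h1 := h.hasDerivAt_lower t ht.1
    have ht1 : t - 1 ∈ Ioc 0 (β + 1) := ⟨by linarith [ht.1], by linarith [ht.2]⟩
    rw [h.upper_eq (t - 1) ht1] at h1
    have ht0 : 0 < t - 1 := by linarith [ht.1]
    have e : (2 : ℝ) * t ^ ((2 : ℝ) - 1) * (A * (t - 1) ^ (-(2 : ℝ))) = φ t := by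
      rw [show (2 : ℝ) - 1 = 1 by norm_num, Real.rpow_one, Real.rpow_neg ht0.le, Real.rpow_two, hφ]
      field_simp
    rw [e] at h1
    exact h1.hasDerivWithinAt
  have hcont : ContinuousOn (fun t : ℝ => t ^ (2 : ℝ) * f t) (Icc β s) := by
    refine ContinuousOn.mul (fun t _ => ?_) (h.continuousOn_lower.mono fun t ht => ?_)
    · exact (Real.continuousAt_rpow_const _ _ (Or.inr (by norm_num))).continuousWithinAt
    · exact lt_of_lt_of_le (by linarith) ht.1
  have hφc : ContinuousOn φ (Icc β s) := by
    simp only [hφ]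
    refine ContinuousOn.div (by fun_prop) (by fun_prop) fun t ht => ?_
    have : 0 < t - 1 := by linarith [ht.1]
    positivity
  have hint : IntervalIntegrable φ volume β s := hφc.intervalIntegrable_of_Icc hlt.le
  have hFTC := integral_eq_sub_of_hasDeriv_right_of_le hlt.le hcont hderiv hint
  have hfβ : f β = 0 := h.lower_eq β ⟨by linarith, le_rfl⟩
  rw [hfβ, mul_zero, sub_zero, Real.rpow_two] at hFTC
  -- evaluate `∫_β^s φ = 2A [log(t-1) - 1/(t-1)]_β^s`
  have hanti : ∀ t ∈ uIcc β s,
      HasDerivAt (fun t : ℝ => 2 * A * (Real.log (t - 1) - (t - 1)⁻¹)) (φ t) t := by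
    intro t ht
    rw [uIcc_of_le hlt.le] at ht
    have ht0 : t - 1 ≠ 0 := by linarith [ht.1]
    have h1 : HasDerivAt (fun t : ℝ => t - 1) 1 t := (hasDerivAt_id t).sub_const 1
    have h2 := ((h1.log ht0).sub (h1.fun_inv ht0)).const_mul (2 * A)
    refine h2.congr_deriv ?_
    rw [hφ]
    field_simp
    ring
  have hval := integral_eq_sub_of_hasDerivAt hanti hint
  rw [hval] at hFTC
  rw [← hFTC]
  ring

/-- **`f_2(s)/A_2` in closed form** on `(β_2, β_2 + 2]`:
`f_2(s) = (2A_2/s²)(log((s − 1)/(β_2 − 1)) − (s − 1)⁻¹ + (β_2 − 1)⁻¹)`. [cite: IwaniecActaArith1980, (1.9)] -/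
theorem iwaniecLowerSieveFun_two_eq {s : ℝ} (hs : iwaniecSiftingLimit 2 ≤ s)
    (hs2 : s ≤ iwaniecSiftingLimit 2 + 2) :
    iwaniecLowerSieveFun 2 s = 2 * iwaniecSieveConst 2 / s ^ 2 *
      (Real.log ((s - 1) / (iwaniecSiftingLimit 2 - 1)) - (s - 1)⁻¹ + (iwaniecSiftingLimit 2 - 1)⁻¹) := by
  have hβ1 := one_lt_iwaniecSiftingLimit_two
  have hs0 : 0 < s := by linarith
  have h := sq_mul_iwaniecLowerSieveFun_two_eq hs hs2
  have hs1 : s - 1 ≠ 0 := by linarith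
  have hb1 : iwaniecSiftingLimit 2 - 1 ≠ 0 := by linarith
  have hs2' : s ^ 2 ≠ 0 := by positivity
  have e : iwaniecLowerSieveFun 2 s = (s ^ 2 * iwaniecLowerSieveFun 2 s) / s ^ 2 := by
    field_simp
  rw [e, h, Real.log_div hs1 hb1]
  field_simp
  ring

/-! ### The value at `s₀ = 498/73` -/

/-- `log (4250000/2798893) ≥ 0.41765` (`exp 0.41765 ≤ 1.51839 < 1.518457…`, by the Taylor bound
`Real.exp_bound'` with six terms). [folklore] -/
theorem log_ratio_ge : (41765 : ℝ) / 100000 ≤ Real.log (4250000 / 2798893) := by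
  rw [Real.le_log_iff_exp_le (by norm_num)]
  have h := Real.exp_bound' (x := (41765 : ℝ) / 100000) (by norm_num) (by norm_num) (n := 6)
    (by norm_num)
  refine h.trans ?_
  simp only [Finset.sum_range_succ, Finset.sum_range_zero, Nat.factorial]
  norm_num

/-- **`f_2(498/73) ≥ 0.02177 · A_2`** (`498/73 = 6.8219… ∈ (β_2, β_2 + 2]`; the true value is
`0.021777… · A_2`): from the closed form with `β_2 ≤ 4.8341` and `log_ratio_ge`. [folklore] -/
theorem iwaniecLowerSieveFun_two_ge :
    2177 / 100000 * iwaniecSieveConst 2 ≤ iwaniecLowerSieveFun 2 (498 / 73) := by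
  set β := iwaniecSiftingLimit 2 with hβdef
  set A := iwaniecSieveConst 2 with hAdef
  have hβlo : 48339 / 10000 < β := iwaniecSiftingLimit_two_gt
  have hβhi : β ≤ 48341 / 10000 := iwaniecSiftingLimit_two_le
  have hA : 0 < A := iwaniecSieveConst_two_pos
  have hs : β ≤ 498 / 73 := by linarith
  have hs2 : (498 : ℝ) / 73 ≤ β + 2 := by linarith
  have h := sq_mul_iwaniecLowerSieveFun_two_eq hs hs2
  -- lower bounds for the bracket
  have hu0 : 0 < β - 1 := by linarith
  have hlog : (41765 : ℝ) / 100000 ≤ Real.log ((498 : ℝ) / 73 - 1) - Real.log (β - 1) := by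
    have h1 : Real.log (β - 1) ≤ Real.log (38341 / 10000) := Real.log_le_log hu0 (by linarith)
    have h2 : Real.log ((498 : ℝ) / 73 - 1) - Real.log (38341 / 10000) =
        Real.log (4250000 / 2798893) := by
      rw [← Real.log_div (by norm_num) (by norm_num)]; norm_num
    linarith [log_ratio_ge]
  have hinv : (10000 : ℝ) / 38341 ≤ (β - 1)⁻¹ := by
    rw [div_le_iff₀ (by norm_num)]
    have : (β - 1)⁻¹ * (β - 1) = 1 := inv_mul_cancel₀ hu0.ne'
    nlinarith
  -- `s₀² f(s₀) = 2A · bracket ≥ 2A · 0.506702…`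
  have hbr : (41765 : ℝ) / 100000 - 73 / 425 + 10000 / 38341 ≤
      Real.log ((498 : ℝ) / 73 - 1) - ((498 : ℝ) / 73 - 1)⁻¹ - Real.log (β - 1) + (β - 1)⁻¹ := by
    norm_num at hlog hinv ⊢
    linarith
  have h2 : 2 * A * ((41765 : ℝ) / 100000 - 73 / 425 + 10000 / 38341) ≤
      ((498 : ℝ) / 73) ^ 2 * iwaniecLowerSieveFun 2 (498 / 73) := by
    rw [h]
    exact mul_le_mul_of_nonneg_left hbr (by linarith)
  nlinarith

/-- `f_2(498/73) > 0`. [folklore] -/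
theorem iwaniecLowerSieveFun_two_pos : 0 < iwaniecLowerSieveFun 2 (498 / 73) :=
  lt_of_lt_of_le (by have := iwaniecSieveConst_two_pos; positivity) iwaniecLowerSieveFun_two_ge

end BetaSieveTwo

end Literature.NumberTheory.Sieve

end
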